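import Summits.AtomisticToContinuum.FouriersLaw.Theorems.PhononMeanFreePathIncoherentChannelLightConeHelper1
import Summits.AtomisticToContinuum.FouriersLaw.Theorems.BondHeatUncertaintySubdiffusiveBondHeatKernelGibbsD
import Summits.AtomisticToContinuum.FouriersLaw.Theorems.IncoherentChannel.Negative.GibbsStein

/-!
# Light-cone stub, helper 2: moments of the mean forecast `v_t = K_t p_N` under the Gibbs state

Helper for the registered stub `stub_lightCone` of line `two-horizons-forecast-loss`
(crux `PhononMeanFreePath.IncoherentChannel`, stmt-AtomisticToContinuum-11811).

Toolkit for the light-cone reduction (`lightCone_reduction`): for `P = pinnedChain ω₂ lam β γ`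
(`ω₂ > 0`, `lam, β, γ ≥ 0`), `T > 0`, `μ₀ = P.gibbsMeasure (N+1) T`, `K_t = P.transitionKernel (N+1) T T t`
and the mean forecast `v_t = fcast … N t = K_t p_N`:

* `lightCone_sq_integral_le` — Jensen `(∫ f)² ≤ ∫ f²` on a probability space;
* `lightCone_integrable_pow_four_transitionKernel` — `p_i⁴ ∈ L¹(K_t z)` (`p⁴ ≤ 32T² e^{H/(2T)}` and
  CEHR (3.4));
* `lightCone_integrable_kernel_integral` — for `0 ≤ g ∈ L¹(μ₀)`, `z ↦ K_t g (z)` is `μ₀`-integrable with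
  `∫ K_t g dμ₀ = ∫ g dμ₀` (invariance `μ₀.bind K_t = μ₀`, part D of the kernel–Gibbs files);
* `lightCone_integrable_momentum_pow`, `lightCone_integral_momentum_pow` — all moments of `p_i` under
  `μ₀` are those of `N(0,T)` (helper 1: the `p_i`-marginal of `μ₀` IS `gaussianReal 0 T`);
* `lightCone_fcast_moments` (registered) — `v_t` is measurable, `v_t², v_t⁴ ∈ L¹(μ₀)`,
  `∫ v_t² dμ₀ ≤ T` and `∫ v_t⁴ dμ₀ ≤ ∫ s⁴ dN(0,T)` (kernel Jensen + invariance), uniformly in `N, t`.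
-/

noncomputable section

namespace Summit.AtomisticToContinuum.FouriersLaw.Theorems.PhononMeanFreePath

open MeasureTheory ProbabilityTheory Set Filter Topology
open scoped NNReal ENNReal
open Literature.MathematicalPhysics.KineticTheory.HeatConduction
open Summit.AtomisticToContinuum.FouriersLaw.Theorems.SubdiffusiveBondHeat
  (pinnedChain_gibbsMeasure_bind_transitionKernel pinnedChain_integral_transitionKernel_gibbsMeasure)
open Summit.AtomisticToContinuum.FouriersLaw.Theorems.IncoherentChannel.Negative.KernelMoments
  (sq_momentum_le_two_mul_hamiltonian integrable_exp_hamiltonian_transitionKernel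
    integrable_sq_momentum_transitionKernel)
open Summit.AtomisticToContinuum.FouriersLaw.Theorems.IncoherentChannel.Negative.GibbsStein (gibbs_sq_momentum)

/-! ### Jensen for the square on a probability space -/

/-- On a probability space, `(∫ f)² ≤ ∫ f²` as soon as `f² ∈ L¹` (variance is non-negative). -/
theorem lightCone_sq_integral_le {α : Type*} [MeasurableSpace α] {μ : Measure α} [IsProbabilityMeasure μ]
    {f : α → ℝ} (hf : AEStronglyMeasurable f μ) (hf2 : Integrable (fun x => f x ^ 2) μ) :
    (∫ x, f x ∂μ) ^ 2 ≤ ∫ x, f x ^ 2 ∂μ := by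
  have hf1 : Integrable f μ := by
    refine (((integrable_const (1 : ℝ)).add hf2).div_const 2).mono' hf (Eventually.of_forall fun x => ?_)
    rw [Real.norm_eq_abs]
    change |f x| ≤ (1 + f x ^ 2) / 2
    nlinarith [sq_nonneg (|f x| - 1), sq_abs (f x)]
  set c := ∫ x, f x ∂μ with hc
  have h0 : 0 ≤ ∫ x, (f x - c) ^ 2 ∂μ := integral_nonneg fun x => sq_nonneg _
  have e : (fun x => (f x - c) ^ 2) = fun x => (f x ^ 2 - 2 * c * f x) + c ^ 2 := by
    funext x; ring
  have h1 : Integrable (fun x => f x ^ 2 - 2 * c * f x) μ := hf2.sub (hf1.const_mul _)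
  rw [e, integral_add h1 (integrable_const _), integral_sub hf2 (hf1.const_mul _), integral_const_mul,
    integral_const, probReal_univ, one_smul, ← hc] at h0
  nlinarith

/-! ### Kernel moments of order four -/

section Kernel

variable {ω₂ lam β γ T : ℝ} (hω : 0 < ω₂) (hl : 0 ≤ lam) (hβ : 0 ≤ β) (hγ : 0 ≤ γ) (hT : 0 < T) {N : ℕ}
include hω hl hβ

/-- `p_i⁴ ≤ 32 T² e^{H/(2T)}` (`p_i² ≤ 2H` and `u² ≤ 2e^u`). -/
theorem lightCone_pow_four_le_exp (hT : 0 < T) (x : PhaseSpace (N + 1)) (i : Fin (N + 1)) :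
    x.2 i ^ 4 ≤ 32 * T ^ 2 * Real.exp (1 / (2 * T) * (pinnedChain ω₂ lam β γ).hamiltonian (N + 1) x) := by
  set H := (pinnedChain ω₂ lam β γ).hamiltonian (N + 1) x with hH
  have hH0 : 0 ≤ H := pinnedChain_hamiltonian_nonneg hω.le hl hβ γ (N + 1) x
  have hx2 : x.2 i ^ 2 ≤ 2 * H := sq_momentum_le_two_mul_hamiltonian hω hl hβ γ x i
  set u := 1 / (2 * T) * H with hu
  have hu0 : 0 ≤ u := by positivity
  have hHu : H = 2 * T * u := by rw [hu]; field_simp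
  have hq := Real.quadratic_le_exp_of_nonneg hu0
  have hx4 : x.2 i ^ 4 ≤ (2 * H) ^ 2 := by
    have := pow_le_pow_left₀ (sq_nonneg (x.2 i)) hx2 2
    calc x.2 i ^ 4 = (x.2 i ^ 2) ^ 2 := by ring
      _ ≤ (2 * H) ^ 2 := this
  rw [hHu] at hx4
  nlinarith [hx4, hq, sq_nonneg T, mul_nonneg (sq_nonneg T) hu0]

include hγ hT

/-- `p_i⁴` is integrable for the equal-temperature transition kernels of the pinned chain. -/
theorem lightCone_integrable_pow_four_transitionKernel (t : ℝ≥0) (z : PhaseSpace (N + 1)) (i : Fin (N + 1)) :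
    Integrable (fun y : PhaseSpace (N + 1) => y.2 i ^ 4)
      ((pinnedChain ω₂ lam β γ).transitionKernel (N + 1) T T t z) := by
  have hE := (integrable_exp_hamiltonian_transitionKernel hω hl hβ hγ (Nat.succ_pos N) hT t z).const_mul
    (32 * T ^ 2)
  refine hE.mono' (by fun_prop : Continuous fun y : PhaseSpace (N + 1) => y.2 i ^ 4).aestronglyMeasurable
    (Eventually.of_forall fun y => ?_)
  rw [Real.norm_eq_abs, abs_of_nonneg (by positivity)]
  exact lightCone_pow_four_le_exp hω hl hβ hT y i

/-- **Invariance with integrability**: for measurable `0 ≤ g ∈ L¹(μ₀)`, the kernel average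
`z ↦ ∫ g dK_t(z)` is `μ₀`-integrable and `∫ (∫ g dK_t(z)) dμ₀(z) = ∫ g dμ₀`. -/
theorem lightCone_integrable_kernel_integral (t : ℝ≥0) {g : PhaseSpace (N + 1) → ℝ} (hgm : Measurable g)
    (hg0 : ∀ y, 0 ≤ g y) (hgi : Integrable g ((pinnedChain ω₂ lam β γ).gibbsMeasure (N + 1) T)) :
    Integrable (fun z => ∫ y, g y ∂((pinnedChain ω₂ lam β γ).transitionKernel (N + 1) T T t z))
        ((pinnedChain ω₂ lam β γ).gibbsMeasure (N + 1) T) ∧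
      ∫ z, (∫ y, g y ∂((pinnedChain ω₂ lam β γ).transitionKernel (N + 1) T T t z))
          ∂((pinnedChain ω₂ lam β γ).gibbsMeasure (N + 1) T) =
        ∫ y, g y ∂((pinnedChain ω₂ lam β γ).gibbsMeasure (N + 1) T) := by
  set P := pinnedChain ω₂ lam β γ with hP
  set κ := P.transitionKernel (N + 1) T T t with hκ
  set μ₀ := P.gibbsMeasure (N + 1) T with hμ₀
  refine ⟨?_, pinnedChain_integral_transitionKernel_gibbsMeasure hω hl hβ hγ (Nat.succ_pos N) hT t hgi⟩
  have hbind : μ₀.bind κ = μ₀ := pinnedChain_gibbsMeasure_bind_transitionKernel hω hl hβ hγ (Nat.succ_pos N) hT t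
  have hgm' : Measurable fun y => ENNReal.ofReal (g y) := hgm.ennreal_ofReal
  have hΦm : Measurable fun z => ∫⁻ y, ENNReal.ofReal (g y) ∂κ z := hgm'.lintegral_kernel
  have h1 : ∫⁻ z, ∫⁻ y, ENNReal.ofReal (g y) ∂κ z ∂μ₀ = ∫⁻ y, ENNReal.ofReal (g y) ∂μ₀ := by
    rw [← Measure.lintegral_bind κ.measurable.aemeasurable hgm'.aemeasurable, hbind]
  have hfin : ∫⁻ y, ENNReal.ofReal (g y) ∂μ₀ < ∞ :=
    (hasFiniteIntegral_iff_ofReal (Eventually.of_forall hg0)).1 hgi.hasFiniteIntegral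
  have heq : (fun z => ∫ y, g y ∂κ z) = fun z => (∫⁻ y, ENNReal.ofReal (g y) ∂κ z).toReal := by
    funext z
    exact integral_eq_lintegral_of_nonneg_ae (Eventually.of_forall hg0) hgm.aestronglyMeasurable
  rw [heq]
  exact integrable_toReal_of_lintegral_ne_top hΦm.aemeasurable (h1 ▸ hfin.ne)

end Kernel

/-! ### Moments of one momentum under the Gibbs state -/

section Momentum

/-- All moments `∫ s^k dN(0,T)` are finite. -/
theorem lightCone_integrable_pow_gaussianReal (T : ℝ) (k : ℕ) :
    Integrable (fun s : ℝ => s ^ k) (gaussianReal 0 T.toNNReal) := by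
  have h := (memLp_id_gaussianReal' (μ := 0) (v := T.toNNReal) (k : ℝ≥0∞) (ENNReal.natCast_ne_top k))
  rcases Nat.eq_zero_or_pos k with hk | hk
  · subst hk; simp only [pow_zero]; exact integrable_const _
  have h2 := h.integrable_norm_pow hk.ne'
  refine h2.congr' (by fun_prop : Continuous fun s : ℝ => s ^ k).aestronglyMeasurable
    (Eventually.of_forall fun s => ?_)
  simp only [id, Real.norm_eq_abs, abs_pow, abs_abs]

variable {ω₂ lam β γ T : ℝ} (hω : 0 < ω₂) (hl : 0 ≤ lam) (hβ : 0 ≤ β) (hT : 0 < T) {N : ℕ}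
include hω hl hβ hT

/-- Every moment of a momentum under the Gibbs state is finite. -/
theorem lightCone_integrable_momentum_pow (i : Fin (N + 1)) (k : ℕ) :
    Integrable (fun z : PhaseSpace (N + 1) => z.2 i ^ k) ((pinnedChain ω₂ lam β γ).gibbsMeasure (N + 1) T) := by
  have hmap := lightCone_gibbs_map_momentum (γ := γ) hω hl hβ hT i (n := N)
  have hpi : Measurable fun z : PhaseSpace (N + 1) => z.2 i := (measurable_pi_apply i).comp measurable_snd
  have h := lightCone_integrable_pow_gaussianReal T k
  rw [← hmap] at h
  exact (integrable_map_measure (by fun_prop : Continuous fun s : ℝ => s ^ k).aestronglyMeasurable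
    hpi.aemeasurable).1 h

/-- The moments of a momentum under the Gibbs state are the Gaussian ones:
`∫ p_i^k dμ₀ = ∫ s^k dN(0,T)`. -/
theorem lightCone_integral_momentum_pow (i : Fin (N + 1)) (k : ℕ) :
    ∫ z, z.2 i ^ k ∂((pinnedChain ω₂ lam β γ).gibbsMeasure (N + 1) T) = ∫ s, s ^ k ∂(gaussianReal 0 T.toNNReal) := by
  have hmap := lightCone_gibbs_map_momentum (γ := γ) hω hl hβ hT i (n := N)
  have hpi : Measurable fun z : PhaseSpace (N + 1) => z.2 i := (measurable_pi_apply i).comp measurable_snd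
  rw [← hmap, integral_map hpi.aemeasurable (by fun_prop : Continuous fun s : ℝ => s ^ k).aestronglyMeasurable]

end Momentum

/-! ### The registered toolkit statement for the mean forecast -/

/-- The mean forecast `v_t = K_t p_N` is a measurable function of the initial microstate. -/
theorem lightCone_measurable_fcast (ω₂ lam β γ T : ℝ) (N : ℕ) (t : ℝ) : Measurable (fcast ω₂ lam β γ T N t) := by
  have h : StronglyMeasurable fun y : PhaseSpace (N + 1) => y.2 (Fin.last N) :=
    ((measurable_pi_apply (Fin.last N)).comp measurable_snd).stronglyMeasurable
  exact (h.integral_kernel (κ := (pinnedChain ω₂ lam β γ).transitionKernel (N + 1) T T t.toNNReal)).measurable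

section Fcast

variable {ω₂ lam β γ T : ℝ} (hω : 0 < ω₂) (hl : 0 ≤ lam) (hβ : 0 ≤ β) (hγ : 0 ≤ γ) (hT : 0 < T)
include hω hl hβ hγ hT

/-- Kernel Jensen: `v_t(z)² ≤ (K_t p_N²)(z)`. -/
theorem lightCone_fcast_sq_le (N : ℕ) (t : ℝ) (z : PhaseSpace (N + 1)) :
    fcast ω₂ lam β γ T N t z ^ 2 ≤
      ∫ y, y.2 (Fin.last N) ^ 2 ∂((pinnedChain ω₂ lam β γ).transitionKernel (N + 1) T T t.toNNReal z) := by
  haveI := pinnedChain_isMarkovKernel_transitionKernel hω hl hβ hγ (N + 1) T T t.toNNReal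
  exact lightCone_sq_integral_le (by fun_prop : Continuous fun y : PhaseSpace (N + 1) => y.2 (Fin.last N)).aestronglyMeasurable
    (integrable_sq_momentum_transitionKernel hω hl hβ hγ (Nat.succ_pos N) hT _ z _)

/-- Kernel Jensen, fourth order: `v_t(z)⁴ ≤ (K_t p_N⁴)(z)`. -/
theorem lightCone_fcast_pow_four_le (N : ℕ) (t : ℝ) (z : PhaseSpace (N + 1)) :
    fcast ω₂ lam β γ T N t z ^ 4 ≤
      ∫ y, y.2 (Fin.last N) ^ 4 ∂((pinnedChain ω₂ lam β γ).transitionKernel (N + 1) T T t.toNNReal z) := by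
  haveI := pinnedChain_isMarkovKernel_transitionKernel hω hl hβ hγ (N + 1) T T t.toNNReal
  have h1 := lightCone_fcast_sq_le hω hl hβ hγ hT N t z
  have h4 : Integrable (fun y : PhaseSpace (N + 1) => (y.2 (Fin.last N) ^ 2) ^ 2)
      ((pinnedChain ω₂ lam β γ).transitionKernel (N + 1) T T t.toNNReal z) := by
    have := lightCone_integrable_pow_four_transitionKernel hω hl hβ hγ hT t.toNNReal z (Fin.last N)
    refine this.congr (Eventually.of_forall fun y => ?_)
    ring
  have h2 := lightCone_sq_integral_le
    (by fun_prop : Continuous fun y : PhaseSpace (N + 1) => y.2 (Fin.last N) ^ 2).aestronglyMeasurable h4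
  have h3 : (fcast ω₂ lam β γ T N t z ^ 2) ^ 2 ≤
      (∫ y, y.2 (Fin.last N) ^ 2 ∂((pinnedChain ω₂ lam β γ).transitionKernel (N + 1) T T t.toNNReal z)) ^ 2 :=
    pow_le_pow_left₀ (sq_nonneg _) h1 2
  calc fcast ω₂ lam β γ T N t z ^ 4 = (fcast ω₂ lam β γ T N t z ^ 2) ^ 2 := by ring
    _ ≤ _ := h3.trans (h2.trans_eq (integral_congr_ae (Eventually.of_forall fun y => by ring)))

end Fcast

/-- **Registered helper `lightCone_fcast_moments`.** For the pinned chain (`ω₂ > 0`, `lam, β, γ ≥ 0`,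
`T > 0`), every `N` and every time `t`: the mean forecast `v_t = K_t p_N` is measurable,
`v_t², v_t⁴ ∈ L¹(μ₀)`, `∫ v_t² dμ₀ ≤ T` and `∫ v_t⁴ dμ₀ ≤ ∫ s⁴ dN(0,T)` — kernel Jensen plus
invariance of `μ₀`, uniformly in `N` and `t`. -/
theorem lightCone_fcast_moments : ∀ ω₂ lam β γ : ℝ, 0 < ω₂ → 0 ≤ lam → 0 ≤ β → 0 ≤ γ → ∀ T : ℝ, 0 < T →
    ∀ (N : ℕ) (t : ℝ), Measurable (fcast ω₂ lam β γ T N t) ∧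
      Integrable (fun z => fcast ω₂ lam β γ T N t z ^ 2) ((pinnedChain ω₂ lam β γ).gibbsMeasure (N + 1) T) ∧
      Integrable (fun z => fcast ω₂ lam β γ T N t z ^ 4) ((pinnedChain ω₂ lam β γ).gibbsMeasure (N + 1) T) ∧
      ∫ z, fcast ω₂ lam β γ T N t z ^ 2 ∂((pinnedChain ω₂ lam β γ).gibbsMeasure (N + 1) T) ≤ T ∧
      ∫ z, fcast ω₂ lam β γ T N t z ^ 4 ∂((pinnedChain ω₂ lam β γ).gibbsMeasure (N + 1) T) ≤
        ∫ s, s ^ 4 ∂(ProbabilityTheory.gaussianReal 0 T.toNNReal) := by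
  intro ω₂ lam β γ hω hl hβ hγ T hT N t
  set P := pinnedChain ω₂ lam β γ with hP
  set μ₀ := P.gibbsMeasure (N + 1) T with hμ₀
  have hmeas := lightCone_measurable_fcast ω₂ lam β γ T N t
  -- the kernel averages of `p_N²`, `p_N⁴`
  have h2 := lightCone_integrable_kernel_integral hω hl hβ hγ hT t.toNNReal
    (g := fun y : PhaseSpace (N + 1) => y.2 (Fin.last N) ^ 2) (by fun_prop) (fun y => sq_nonneg _)
    (lightCone_integrable_momentum_pow hω hl hβ hT (Fin.last N) 2)
  have h4 := lightCone_integrable_kernel_integral hω hl hβ hγ hT t.toNNReal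
    (g := fun y : PhaseSpace (N + 1) => y.2 (Fin.last N) ^ 4) (by fun_prop) (fun y => by positivity)
    (lightCone_integrable_momentum_pow hω hl hβ hT (Fin.last N) 4)
  have hI2 : Integrable (fun z => fcast ω₂ lam β γ T N t z ^ 2) μ₀ :=
    h2.1.mono' (hmeas.pow_const 2).aestronglyMeasurable (Eventually.of_forall fun z => by
      rw [Real.norm_eq_abs, abs_of_nonneg (sq_nonneg _)]
      exact lightCone_fcast_sq_le hω hl hβ hγ hT N t z)
  have hI4 : Integrable (fun z => fcast ω₂ lam β γ T N t z ^ 4) μ₀ :=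
    h4.1.mono' (hmeas.pow_const 4).aestronglyMeasurable (Eventually.of_forall fun z => by
      rw [Real.norm_eq_abs, abs_of_nonneg (by positivity)]
      exact lightCone_fcast_pow_four_le hω hl hβ hγ hT N t z)
  refine ⟨hmeas, hI2, hI4, ?_, ?_⟩
  · calc ∫ z, fcast ω₂ lam β γ T N t z ^ 2 ∂μ₀
        ≤ ∫ z, (∫ y, y.2 (Fin.last N) ^ 2 ∂(P.transitionKernel (N + 1) T T t.toNNReal z)) ∂μ₀ :=
          integral_mono hI2 h2.1 fun z => lightCone_fcast_sq_le hω hl hβ hγ hT N t z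
      _ = ∫ y, y.2 (Fin.last N) ^ 2 ∂μ₀ := h2.2
      _ = T := gibbs_sq_momentum hω hl hβ hT (Fin.last N)
  · calc ∫ z, fcast ω₂ lam β γ T N t z ^ 4 ∂μ₀
        ≤ ∫ z, (∫ y, y.2 (Fin.last N) ^ 4 ∂(P.transitionKernel (N + 1) T T t.toNNReal z)) ∂μ₀ :=
          integral_mono hI4 h4.1 fun z => lightCone_fcast_pow_four_le hω hl hβ hγ hT N t z
      _ = ∫ y, y.2 (Fin.last N) ^ 4 ∂μ₀ := h4.2
      _ = ∫ s, s ^ 4 ∂(gaussianReal 0 T.toNNReal) := lightCone_integral_momentum_pow hω hl hβ hT (Fin.last N) 4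

end Summit.AtomisticToContinuum.FouriersLaw.Theorems.PhononMeanFreePath

end
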